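import Summits.Ventures.LatticeQCDFlow.Exactness.FlowAcceptanceOverlap
import HarnessLib

/-!
# The flow sampler's equilibrium acceptance is 1-Lipschitz in the model density in `L¹` — on a general state space

HONEST FRAMING: exact (Metropolis-corrected) sampling algorithms for lattice gauge theory;
figures of merit are autocorrelation/cost numbers at stated couplings and volumes; no
continuum-physics claim.

Venture `LatticeQCDFlow` (cell pub-lqcd), topic `Exactness`; FANOUT row 4 (`s0-u1-b`, rung S0-B
implementation B: an independent code path for the 2D U(1) flow, compared with implementation A by
'acceptance A vs B within 3 pp at every β').  NEW WORK of the cell — iterated integrals over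
Mathlib, in the setting and with the integrability toolbox of row 2's
`Exactness/FlowAcceptanceOverlap.lean` (`integrable_min_mul`, `integrable_integral_min_mul`;
`ā = ∫∫ min(p(x)q(y), p(y)q(x))` the equilibrium acceptance of the exact flow sampler); nothing is
cited as a fact, no definition is introduced.  It is the general-state-space form of the
finite-state law `Theory2.abs_accRate_sub_accRate_le_two_mul_tvDist_right`
(`Scaling/AcceptanceTransfer.lean`, `Scaling/AcceptanceModelLipschitz.lean`): row 4's two codes
sample a CONTINUOUS configuration space (`U(1)^E`), and the finite law only speaks about
discretisations of it.

## What is proved (`(X, μ)` with `μ` s-finite; `p ≥ 0` the target density, `q, q' ≥ 0` two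
## model densities, all measurable and integrable with `∫ p = ∫ q = ∫ q' = 1`)

* `min_eq_half_add_sub_half_abs` — `min a b = (a + b)/2 − |a − b|/2`;
  `integral_min_mul_eq` — for every `x`:
  `∫ min(p(x)q(y), p(y)q(x)) dμ(y) = (p(x) + q(x))/2 − ½ ∫ |p(x)q(y) − p(y)q(x)| dμ(y)`;
* **`meanAccept_eq_one_sub_half_pairTV`** —
  `ā = 1 − ½ ∫∫ |p(x)q(y) − p(y)q(x)| dμ(y) dμ(x)`: the equilibrium acceptance is one minus the
  total-variation distance between the two orderings `p ⊗ q`, `q ⊗ p` of the pair law (the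
  general-space form of `Theory2.accRate_eq_one_sub_tvDist_prodLaw`);
* `abs_integral_abs_pairDiff_sub_le` — per state:
  `|∫|p(x)q(y) − p(y)q(x)| dμ(y) − ∫|p(x)q'(y) − p(y)q'(x)| dμ(y)| ≤ p(x)·∫|q − q'| + |q(x) − q'(x)|`;
* **`abs_meanAccept_sub_le_integral_abs_sub`** — THE LAW:
  `|ā(p, q) − ā(p, q')| ≤ ∫ |q − q'| dμ = 2‖q − q'‖_TV`; `abs_meanAccept_sub_le_integral_abs_sub_target`
  — the same in the target at a fixed model (`ā` is symmetric in `p`, `q`);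
* **`abs_meanAccept_sub_le_exp_sub_one`** — PARITY reading: positive models agreeing to `δ` in log
  uniformly (`|log q − log q'| ≤ δ`) have equilibrium acceptances within `e^δ − 1` at any target;
* **`abs_meanAccept_sub_le_of_logParityOff`** — MEASURED-PARITY reading: if the parity holds only
  off a measurable exceptional set `E`, the acceptances are within
  `(e^δ − 1)·∫_{Eᶜ} q + ∫_E q + ∫_E q'` — what matters is the mass of `E` under the two MODELS, not
  under the target (`integral_abs_sub_le_of_logParityOff`).

Reading for row 4 (value-free, no number of ours, no sealed value): with the same trained weights
the two codes realise one model density up to their numerical parity; a parity verified on draws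
from the model bounds the exceptional set in model probability, which is exactly the currency of
the acceptance column — on the continuous configuration space itself, not on a discretisation.
The `τ_int` column is NOT controlled this way (`Scaling/DensityParityCertificates.lean`, finite
witness; `Exactness/IMHTauIntModelComparison.lean`, the uniform-parity law).  NOT CLAIMED: anything
out of equilibrium; kernel-level (per-state) Lipschitz bounds; HMC / local Metropolis.
-/

namespace Summit.Ventures.LatticeQCDFlow.Exactness.MeanAcceptLipschitz

open Real MeasureTheory Filter Set

variable {X : Type*} [MeasurableSpace X] {μ : Measure X} {p q q' : X → ℝ}

/-! ### Pointwise and per-state identities -/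

/-- `min a b = (a + b)/2 − |a − b|/2`. [folklore] -/
theorem min_eq_half_add_sub_half_abs (a b : ℝ) : min a b = (a + b) / 2 - |a - b| / 2 := by
  rcases le_total a b with h | h
  · rw [min_eq_left h, abs_of_nonpos (sub_nonpos.2 h)]
    ring
  · rw [min_eq_right h, abs_of_nonneg (sub_nonneg.2 h)]
    ring

/-- The pair-difference integrand `y ↦ |p(x)q(y) − p(y)q(x)|` is integrable. -/
theorem integrable_abs_pairDiff (hpi : Integrable p μ) (hqi : Integrable q μ) (x : X) :
    Integrable (fun y => |p x * q y - p y * q x|) μ :=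
  ((hqi.const_mul (p x)).sub (hpi.mul_const (q x))).abs

/-- **Per-state identity**: `∫ min(p(x)q(y), p(y)q(x)) dμ(y) = (p(x) + q(x))/2 − ½∫|p(x)q(y) − p(y)q(x)| dμ(y)`
(`∫ p = ∫ q = 1`). -/
theorem integral_min_mul_eq (hpi : Integrable p μ) (hp1 : ∫ x, p x ∂μ = 1) (hqi : Integrable q μ)
    (hq1 : ∫ x, q x ∂μ = 1) (x : X) :
    ∫ y, min (p x * q y) (p y * q x) ∂μ
      = (p x + q x) / 2 - (∫ y, |p x * q y - p y * q x| ∂μ) / 2 := by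
  have h1 : Integrable (fun y => p x * q y) μ := hqi.const_mul _
  have h2 : Integrable (fun y => p y * q x) μ := hpi.mul_const _
  have h3 := integrable_abs_pairDiff hpi hqi x
  calc ∫ y, min (p x * q y) (p y * q x) ∂μ
      = ∫ y, ((p x * q y + p y * q x) / 2 - |p x * q y - p y * q x| / 2) ∂μ :=
        integral_congr_ae (Eventually.of_forall fun y => min_eq_half_add_sub_half_abs _ _)
    _ = (∫ y, (p x * q y + p y * q x) / 2 ∂μ) - ∫ y, |p x * q y - p y * q x| / 2 ∂μ :=
        integral_sub ((h1.add h2).div_const 2) (h3.div_const 2)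
    _ = (p x + q x) / 2 - (∫ y, |p x * q y - p y * q x| ∂μ) / 2 := by
        rw [integral_div, integral_div, integral_add h1 h2, integral_const_mul, integral_mul_const,
          hq1, hp1, mul_one, one_mul]

/-- **Per-state Lipschitz bound** (`p ≥ 0`, `∫ p = 1`):
`|∫|p(x)q(y) − p(y)q(x)| dμ(y) − ∫|p(x)q'(y) − p(y)q'(x)| dμ(y)| ≤ p(x)·∫|q − q'| dμ + |q(x) − q'(x)|`. -/
theorem abs_integral_abs_pairDiff_sub_le (hp0 : ∀ x, 0 ≤ p x) (hpi : Integrable p μ)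
    (hp1 : ∫ x, p x ∂μ = 1) (hqi : Integrable q μ) (hqi' : Integrable q' μ) (x : X) :
    |(∫ y, |p x * q y - p y * q x| ∂μ) - ∫ y, |p x * q' y - p y * q' x| ∂μ|
      ≤ p x * ∫ y, |q y - q' y| ∂μ + |q x - q' x| := by
  have h3 := integrable_abs_pairDiff hpi hqi x
  have h3' := integrable_abs_pairDiff hpi hqi' x
  have hΔ : Integrable (fun y => |q y - q' y|) μ := (hqi.sub hqi').abs
  have hdom : Integrable (fun y => p x * |q y - q' y| + p y * |q x - q' x|) μ :=
    (hΔ.const_mul _).add (hpi.mul_const _)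
  rw [← integral_sub h3 h3']
  calc |∫ y, (|p x * q y - p y * q x| - |p x * q' y - p y * q' x|) ∂μ|
      ≤ ∫ y, |(|p x * q y - p y * q x| - |p x * q' y - p y * q' x|)| ∂μ :=
        abs_integral_le_integral_abs
    _ ≤ ∫ y, (p x * |q y - q' y| + p y * |q x - q' x|) ∂μ := by
        refine integral_mono (h3.sub h3').abs hdom fun y => ?_
        dsimp only
        calc |(|p x * q y - p y * q x| - |p x * q' y - p y * q' x|)|
            ≤ |(p x * q y - p y * q x) - (p x * q' y - p y * q' x)| :=
              abs_abs_sub_abs_le_abs_sub _ _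
          _ = |p x * (q y - q' y) - p y * (q x - q' x)| := by congr 1; ring
          _ ≤ |p x * (q y - q' y)| + |p y * (q x - q' x)| := abs_sub _ _
          _ = p x * |q y - q' y| + p y * |q x - q' x| := by
              rw [abs_mul, abs_mul, abs_of_nonneg (hp0 x), abs_of_nonneg (hp0 y)]
    _ = p x * ∫ y, |q y - q' y| ∂μ + |q x - q' x| := by
        rw [integral_add (hΔ.const_mul _) (hpi.mul_const _), integral_const_mul, integral_mul_const,
          hp1, one_mul]

/-- Pointwise parity-to-difference, symmetric form: `|log a − log b| ≤ δ` for `a, b > 0` gives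
`|a − b| ≤ (e^δ − 1)·min(a, b)`. [folklore] -/
theorem abs_sub_le_exp_sub_one_mul_min {a b δ : ℝ} (ha : 0 < a) (hb : 0 < b)
    (h : |Real.log a - Real.log b| ≤ δ) : |a - b| ≤ (Real.exp δ - 1) * min a b := by
  rw [abs_sub_le_iff] at h
  have h1 : b ≤ Real.exp δ * a := by
    have : Real.log b ≤ δ + Real.log a := by linarith [h.2]
    calc b = Real.exp (Real.log b) := (Real.exp_log hb).symm
      _ ≤ Real.exp (δ + Real.log a) := Real.exp_le_exp.2 this
      _ = Real.exp δ * a := by rw [Real.exp_add, Real.exp_log ha]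
  have h2 : a ≤ Real.exp δ * b := by
    have : Real.log a ≤ δ + Real.log b := by linarith [h.1]
    calc a = Real.exp (Real.log a) := (Real.exp_log ha).symm
      _ ≤ Real.exp (δ + Real.log b) := Real.exp_le_exp.2 this
      _ = Real.exp δ * b := by rw [Real.exp_add, Real.exp_log hb]
  rcases le_total a b with hab | hba
  · rw [abs_of_nonpos (sub_nonpos.2 hab), min_eq_left hab]
    linarith
  · rw [abs_of_nonneg (sub_nonneg.2 hba), min_eq_right hba]
    linarith

omit [MeasurableSpace X] in
/-- `ā` is symmetric in target and model: the integrand `min(p(x)q(y), p(y)q(x))` is. -/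
theorem min_mul_swap (x y : X) : min (q x * p y) (q y * p x) = min (p x * q y) (p y * q x) := by
  rw [min_comm, mul_comm (q y), mul_comm (q x)]

/-! ### The equilibrium acceptance: pair-TV identity and the Lipschitz law -/

variable [SFinite μ]

/-- The per-state pair-difference mass `x ↦ ∫|p(x)q(y) − p(y)q(x)| dμ(y)` is measurable. -/
theorem measurable_integral_abs_pairDiff (hpm : Measurable p) (hqm : Measurable q) :
    Measurable fun x => ∫ y, |p x * q y - p y * q x| ∂μ := by
  have hF : Measurable fun z : X × X => |p z.1 * q z.2 - p z.2 * q z.1| :=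
    (((hpm.comp measurable_fst).mul (hqm.comp measurable_snd)).sub
      ((hpm.comp measurable_snd).mul (hqm.comp measurable_fst))).abs
  exact (hF.stronglyMeasurable.integral_prod_right (ν := μ)).measurable

/-- … and integrable, dominated by `p(x) + q(x)` (`p, q ≥ 0`, `∫ p = ∫ q = 1`). -/
theorem integrable_integral_abs_pairDiff (hp0 : ∀ x, 0 ≤ p x) (hpm : Measurable p)
    (hpi : Integrable p μ) (hp1 : ∫ x, p x ∂μ = 1) (hq0 : ∀ x, 0 ≤ q x) (hqm : Measurable q)
    (hqi : Integrable q μ) (hq1 : ∫ x, q x ∂μ = 1) :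
    Integrable (fun x => ∫ y, |p x * q y - p y * q x| ∂μ) μ := by
  refine Integrable.mono' (hpi.add hqi) (measurable_integral_abs_pairDiff hpm hqm).aestronglyMeasurable
    (Eventually.of_forall fun x => ?_)
  have h0 : 0 ≤ ∫ y, |p x * q y - p y * q x| ∂μ := integral_nonneg fun y => abs_nonneg _
  rw [Real.norm_eq_abs, abs_of_nonneg h0]
  have h1 : Integrable (fun y => p x * q y) μ := hqi.const_mul _
  have h2 : Integrable (fun y => p y * q x) μ := hpi.mul_const _
  calc ∫ y, |p x * q y - p y * q x| ∂μ ≤ ∫ y, (p x * q y + p y * q x) ∂μ := by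
        refine integral_mono (integrable_abs_pairDiff hpi hqi x) (h1.add h2) fun y => ?_
        dsimp only
        have ha : 0 ≤ p x * q y := mul_nonneg (hp0 x) (hq0 y)
        have hb : 0 ≤ p y * q x := mul_nonneg (hp0 y) (hq0 x)
        rw [abs_sub_le_iff]
        constructor <;> linarith
    _ = p x + q x := by
        rw [integral_add h1 h2, integral_const_mul, integral_mul_const, hq1, hp1, mul_one, one_mul]

/-- **`ā = 1 − TV(p ⊗ q, q ⊗ p)`** on a general state space: the equilibrium acceptance of the exact
flow sampler is `1 − ½∫∫|p(x)q(y) − p(y)q(x)| dμ(y) dμ(x)`. [folklore] -/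
theorem meanAccept_eq_one_sub_half_pairTV (hp0 : ∀ x, 0 ≤ p x) (hpm : Measurable p)
    (hpi : Integrable p μ) (hp1 : ∫ x, p x ∂μ = 1) (hq0 : ∀ x, 0 ≤ q x) (hqm : Measurable q)
    (hqi : Integrable q μ) (hq1 : ∫ x, q x ∂μ = 1) :
    ∫ x, ∫ y, min (p x * q y) (p y * q x) ∂μ ∂μ
      = 1 - (∫ x, ∫ y, |p x * q y - p y * q x| ∂μ ∂μ) / 2 := by
  have hI := integrable_integral_abs_pairDiff hp0 hpm hpi hp1 hq0 hqm hqi hq1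
  calc ∫ x, ∫ y, min (p x * q y) (p y * q x) ∂μ ∂μ
      = ∫ x, ((p x + q x) / 2 - (∫ y, |p x * q y - p y * q x| ∂μ) / 2) ∂μ :=
        integral_congr_ae (Eventually.of_forall fun x => integral_min_mul_eq hpi hp1 hqi hq1 x)
    _ = (∫ x, (p x + q x) / 2 ∂μ) - ∫ x, (∫ y, |p x * q y - p y * q x| ∂μ) / 2 ∂μ :=
        integral_sub ((hpi.add hqi).div_const 2) (hI.div_const 2)
    _ = 1 - (∫ x, ∫ y, |p x * q y - p y * q x| ∂μ ∂μ) / 2 := by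
        rw [integral_div, integral_div, integral_add hpi hqi, hp1, hq1]
        norm_num

/-- **THE LAW: the equilibrium acceptance is 1-Lipschitz in the model density in `L¹(μ)`**
(`= 2`-Lipschitz in total variation): at one target `p`, two model densities `q`, `q'` have
`|ā(p, q) − ā(p, q')| ≤ ∫ |q − q'| dμ`. [folklore] -/
theorem abs_meanAccept_sub_le_integral_abs_sub (hp0 : ∀ x, 0 ≤ p x) (hpm : Measurable p)
    (hpi : Integrable p μ) (hp1 : ∫ x, p x ∂μ = 1) (hq0 : ∀ x, 0 ≤ q x) (hqm : Measurable q)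
    (hqi : Integrable q μ) (hq1 : ∫ x, q x ∂μ = 1) (hq0' : ∀ x, 0 ≤ q' x) (hqm' : Measurable q')
    (hqi' : Integrable q' μ) (hq1' : ∫ x, q' x ∂μ = 1) :
    |(∫ x, ∫ y, min (p x * q y) (p y * q x) ∂μ ∂μ) - ∫ x, ∫ y, min (p x * q' y) (p y * q' x) ∂μ ∂μ|
      ≤ ∫ x, |q x - q' x| ∂μ := by
  have hI := integrable_integral_abs_pairDiff hp0 hpm hpi hp1 hq0 hqm hqi hq1
  have hI' := integrable_integral_abs_pairDiff hp0 hpm hpi hp1 hq0' hqm' hqi' hq1'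
  have hΔ : Integrable (fun x => |q x - q' x|) μ := (hqi.sub hqi').abs
  rw [meanAccept_eq_one_sub_half_pairTV hp0 hpm hpi hp1 hq0 hqm hqi hq1,
    meanAccept_eq_one_sub_half_pairTV hp0 hpm hpi hp1 hq0' hqm' hqi' hq1']
  set A := ∫ x, ∫ y, |p x * q y - p y * q x| ∂μ ∂μ with hA
  set B := ∫ x, ∫ y, |p x * q' y - p y * q' x| ∂μ ∂μ with hB
  have hsub : A - B
      = ∫ x, ((∫ y, |p x * q y - p y * q x| ∂μ) - ∫ y, |p x * q' y - p y * q' x| ∂μ) ∂μ :=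
    (integral_sub hI hI').symm
  have key : |A - B| ≤ 2 * ∫ x, |q x - q' x| ∂μ := by
    rw [hsub]
    calc |∫ x, ((∫ y, |p x * q y - p y * q x| ∂μ) - ∫ y, |p x * q' y - p y * q' x| ∂μ) ∂μ|
        ≤ ∫ x, |(∫ y, |p x * q y - p y * q x| ∂μ) - ∫ y, |p x * q' y - p y * q' x| ∂μ| ∂μ :=
          abs_integral_le_integral_abs
      _ ≤ ∫ x, (p x * ∫ y, |q y - q' y| ∂μ + |q x - q' x|) ∂μ :=
          integral_mono (hI.sub hI').abs ((hpi.mul_const _).add hΔ)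
            fun x => abs_integral_abs_pairDiff_sub_le hp0 hpi hp1 hqi hqi' x
      _ = 2 * ∫ x, |q x - q' x| ∂μ := by
          rw [integral_add (hpi.mul_const _) hΔ, integral_mul_const, hp1, one_mul, two_mul]
  rw [show (1 : ℝ) - A / 2 - (1 - B / 2) = -((A - B) / 2) by ring, abs_neg, abs_div, abs_two]
  linarith

/-- **… and 1-Lipschitz in the target density** at a fixed model: `|ā(p, q) − ā(p', q)| ≤ ∫ |p − p'| dμ`.
[folklore] -/
theorem abs_meanAccept_sub_le_integral_abs_sub_target {p' : X → ℝ} (hp0 : ∀ x, 0 ≤ p x)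
    (hpm : Measurable p) (hpi : Integrable p μ) (hp1 : ∫ x, p x ∂μ = 1) (hp0' : ∀ x, 0 ≤ p' x)
    (hpm' : Measurable p') (hpi' : Integrable p' μ) (hp1' : ∫ x, p' x ∂μ = 1) (hq0 : ∀ x, 0 ≤ q x)
    (hqm : Measurable q) (hqi : Integrable q μ) (hq1 : ∫ x, q x ∂μ = 1) :
    |(∫ x, ∫ y, min (p x * q y) (p y * q x) ∂μ ∂μ) - ∫ x, ∫ y, min (p' x * q y) (p' y * q x) ∂μ ∂μ|
      ≤ ∫ x, |p x - p' x| ∂μ := by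
  have h := abs_meanAccept_sub_le_integral_abs_sub (p := q) (q := p) (q' := p') hq0 hqm hqi hq1 hp0
    hpm hpi hp1 hp0' hpm' hpi' hp1'
  simp_rw [min_mul_swap (p := p) (q := q), min_mul_swap (p := p') (q := q)] at h
  exact h

/-! ### Parity readings: uniform, and off an exceptional set -/

omit [SFinite μ] in
/-- **`∫|q − q'| ≤ (e^δ − 1)·∫_{Eᶜ} q + ∫_E q + ∫_E q'`** for positive integrable densities that agree
to `δ` in log OFF a measurable exceptional set `E` (nothing assumed on `E`). [folklore] -/
theorem integral_abs_sub_le_of_logParityOff (hq0 : ∀ x, 0 < q x) (hqi : Integrable q μ)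
    (hq0' : ∀ x, 0 < q' x) (hqi' : Integrable q' μ) {E : Set X} (hE : MeasurableSet E) {δ : ℝ}
    (hlog : ∀ x, x ∉ E → |Real.log (q x) - Real.log (q' x)| ≤ δ) :
    ∫ x, |q x - q' x| ∂μ
      ≤ (Real.exp δ - 1) * (∫ x in Eᶜ, q x ∂μ) + (∫ x in E, q x ∂μ + ∫ x in E, q' x ∂μ) := by
  have hg1 : Integrable (E.indicator fun x => q x + q' x) μ := (hqi.add hqi').indicator hE
  have hg2 : Integrable (Eᶜ.indicator fun x => (Real.exp δ - 1) * q x) μ :=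
    (hqi.const_mul _).indicator hE.compl
  calc ∫ x, |q x - q' x| ∂μ
      ≤ ∫ x, (E.indicator (fun x => q x + q' x) x
          + Eᶜ.indicator (fun x => (Real.exp δ - 1) * q x) x) ∂μ := by
        refine integral_mono ((hqi.sub hqi').abs) (hg1.add hg2) fun x => ?_
        dsimp only
        by_cases hx : x ∈ E
        · rw [indicator_of_mem hx, indicator_of_notMem (show x ∉ Eᶜ by simpa using hx), add_zero,
            abs_sub_le_iff]
          have h1 := hq0 x
          have h2 := hq0' x
          constructor <;> linarith
        · rw [indicator_of_notMem hx, indicator_of_mem (mem_compl hx), zero_add]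
          have he : 0 ≤ Real.exp δ - 1 := by
            linarith [Real.add_one_le_exp δ, (abs_nonneg _).trans (hlog x hx)]
          exact (abs_sub_le_exp_sub_one_mul_min (hq0 x) (hq0' x) (hlog x hx)).trans
            (mul_le_mul_of_nonneg_left (min_le_left _ _) he)
    _ = (Real.exp δ - 1) * (∫ x in Eᶜ, q x ∂μ) + (∫ x in E, q x ∂μ + ∫ x in E, q' x ∂μ) := by
        rw [integral_add hg1 hg2, integral_indicator hE, integral_indicator hE.compl,
          integral_const_mul, integral_add (hqi.integrableOn) (hqi'.integrableOn), add_comm]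

/-- **PARITY reading (uniform).**  Two positive model densities that agree to `δ` in log everywhere
have equilibrium acceptances within `e^δ − 1` at any common target. [folklore] -/
theorem abs_meanAccept_sub_le_exp_sub_one (hp0 : ∀ x, 0 ≤ p x) (hpm : Measurable p)
    (hpi : Integrable p μ) (hp1 : ∫ x, p x ∂μ = 1) (hq0 : ∀ x, 0 < q x) (hqm : Measurable q)
    (hqi : Integrable q μ) (hq1 : ∫ x, q x ∂μ = 1) (hq0' : ∀ x, 0 < q' x) (hqm' : Measurable q')
    (hqi' : Integrable q' μ) (hq1' : ∫ x, q' x ∂μ = 1) {δ : ℝ}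
    (hlog : ∀ x, |Real.log (q x) - Real.log (q' x)| ≤ δ) :
    |(∫ x, ∫ y, min (p x * q y) (p y * q x) ∂μ ∂μ) - ∫ x, ∫ y, min (p x * q' y) (p y * q' x) ∂μ ∂μ|
      ≤ Real.exp δ - 1 := by
  refine (abs_meanAccept_sub_le_integral_abs_sub hp0 hpm hpi hp1 (fun x => (hq0 x).le) hqm hqi hq1
    (fun x => (hq0' x).le) hqm' hqi' hq1').trans ?_
  calc ∫ x, |q x - q' x| ∂μ ≤ ∫ x, (Real.exp δ - 1) * q x ∂μ := by
        refine integral_mono ((hqi.sub hqi').abs) (hqi.const_mul _) fun x => ?_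
        have he : 0 ≤ Real.exp δ - 1 := by
          linarith [Real.add_one_le_exp δ, (abs_nonneg _).trans (hlog x)]
        exact (abs_sub_le_exp_sub_one_mul_min (hq0 x) (hq0' x) (hlog x)).trans
          (mul_le_mul_of_nonneg_left (min_le_left _ _) he)
    _ = Real.exp δ - 1 := by rw [integral_const_mul, hq1, mul_one]

/-- **MEASURED-PARITY reading.**  If the two positive model densities agree to `δ` in log only OFF
a measurable exceptional set `E`, the equilibrium acceptances at any common target are within
`(e^δ − 1)·∫_{Eᶜ} q + ∫_E q + ∫_E q'`: the exceptional set enters through its mass under the two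
MODELS only. [folklore] -/
theorem abs_meanAccept_sub_le_of_logParityOff (hp0 : ∀ x, 0 ≤ p x) (hpm : Measurable p)
    (hpi : Integrable p μ) (hp1 : ∫ x, p x ∂μ = 1) (hq0 : ∀ x, 0 < q x) (hqm : Measurable q)
    (hqi : Integrable q μ) (hq1 : ∫ x, q x ∂μ = 1) (hq0' : ∀ x, 0 < q' x) (hqm' : Measurable q')
    (hqi' : Integrable q' μ) (hq1' : ∫ x, q' x ∂μ = 1) {E : Set X} (hE : MeasurableSet E) {δ : ℝ}
    (hlog : ∀ x, x ∉ E → |Real.log (q x) - Real.log (q' x)| ≤ δ) :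
    |(∫ x, ∫ y, min (p x * q y) (p y * q x) ∂μ ∂μ) - ∫ x, ∫ y, min (p x * q' y) (p y * q' x) ∂μ ∂μ|
      ≤ (Real.exp δ - 1) * (∫ x in Eᶜ, q x ∂μ) + (∫ x in E, q x ∂μ + ∫ x in E, q' x ∂μ) :=
  (abs_meanAccept_sub_le_integral_abs_sub hp0 hpm hpi hp1 (fun x => (hq0 x).le) hqm hqi hq1
    (fun x => (hq0' x).le) hqm' hqi' hq1').trans
    (integral_abs_sub_le_of_logParityOff hq0 hqi hq0' hqi' hE hlog)

end Summit.Ventures.LatticeQCDFlow.Exactness.MeanAcceptLipschitz
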